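import Mathlib
import HarnessLib
import HarnessLib.Audit
import Summits.AtomisticToContinuum.Statement
import Literature.MathematicalPhysics.QuantumManyBody.PeriodicBoseGas
import HarnessLib.Audit.Status.Attr

/-!
Route: BECRecoilCorrector

CLOSED (retired) 2026-08-15T13:40:05Z by operator:999:1257524 — reason: not-a-thesis: assembly does not conclude the sub-problem Statement — note: D-0027 §2.1 audit (human 2026-08-15: routes that do not decide the summit are removed): the assembly concludes `Literature.MathematicalPhysics.QuantumManyBody.BoseGas.BoseEinsteinCondensation`, not the sub-problem statement; a NEW conforming route may be opened from the same idea (generated `closes . The file is kept as the record of this route; refuted decls are indexed as negative knowledge (`ledger negatives`).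

# Route BECRecoilCorrector — recoil-regularised Kipnis–Varadhan correctors of the insertion
amplitude give torus BEC from a static response bound

X = INSERTION RESIDUE (card kv-insertion-corrector, its K1+K2 output; "it suffices to show X"): for
every repulsive finite-range v there is
ρ₀ > 0 such that for 0 < ρ < ρ₀ there is c > 0 with: for all large N there is δ > 0 such that every
δ-near-minimiser Θ of the PERIODIC
N-body energy and every δ-near-minimiser Ψ of the periodic (N+1)-body energy on the same torus of
side L = ((N+1)/ρ)^{1/3} satisfy
|⟨φ₀ ⊗ Θ, Ψ⟩|² = L⁻³ |∫_{cell^N} conj Θ(X) ∫_{cell} Ψ(x, X) dx dX|² ≥ c (φ₀ = L^{-3/2} the constant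
mode): adding ONE zero-momentum
particle to the N-particle ground state lands on the (N+1)-particle ground state with overlap
bounded below — no orthogonality
catastrophe in the particle-insertion channel. X ⇒ PeriodicBEC by Cauchy–Schwarz (γ_Ψ ≥ (N+1)|g⟩⟨g|,
support ResidueCondenses), and the
shared transfer crux BoundaryTransferWeak (route BECPeriodicReduction) gives the Dirichlet conjunct.
X itself is to come as
StaticResponseBound → CorrectorClosure: h := Ψ_{N+1}/Ψ_N > 0 solves the EXACT linear eigen-equation
(−G_N − Δ_y + Σ_j v(y−x_j)) h = μ_N h
over the ground-state diffusion G_N of the N-gas (invariant law |Ψ_N|²), Z_N := |⟨φ₀⊗Ψ_N, Ψ_{N+1}⟩|²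
= (E h)²/E h², and −log h is
expanded in Kipnis–Varadhan correctors χ₁ = (−G_N−Δ_y)⁻¹W̃, χ₂ = (−G_N−Δ_y)⁻¹(|∇χ₁|² − E|∇χ₁|²), …
whose L² and Dirichlet norms are
controlled by the STATIC density response of the bath alone, because the added particle's recoil k²
regularises ω → 0:
(ω + k²)⁻² ≤ (4ωk²)⁻¹ gives ‖χ₁‖² ≤ (ρ/4)∫|v̂(k)|² m₋₁(k) k⁻² d³k/(2π)³, finite in d = 3 iff m₋₁(k)
= ∫S(k,ω)ω⁻¹dω stays bounded as k → 0.
Lean: `∀ v : ℝ → ENNReal,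
Literature.MathematicalPhysics.QuantumManyBody.BoseGas.IsRepulsiveFiniteRange v → ∃ ρ₀ : ℝ, 0 < ρ₀ ∧
∀ ρ : ℝ, 0 < ρ → ρ < ρ₀ → ∃ c : ℝ, 0 < c ∧ ∀ᶠ N : ℕ in Filter.atTop, ∃ δ : ENNReal, 0 < δ ∧ ∀ Θ :
Literature.MathematicalPhysics.QuantumManyBody.BoseGas.PeriodicTrialState N
(Literature.MathematicalPhysics.QuantumManyBody.BoseGas.sideLength ρ (N + 1)), ∀ Ψ :
Literature.MathematicalPhysics.QuantumManyBody.BoseGas.PeriodicTrialState (N + 1)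
(Literature.MathematicalPhysics.QuantumManyBody.BoseGas.sideLength ρ (N + 1)),
Literature.MathematicalPhysics.QuantumManyBody.BoseGas.periodicEnergy v Θ ≤
Literature.MathematicalPhysics.QuantumManyBody.BoseGas.periodicGroundStateEnergy v N
(Literature.MathematicalPhysics.QuantumManyBody.BoseGas.sideLength ρ (N + 1)) + δ →
Literature.MathematicalPhysics.QuantumManyBody.BoseGas.periodicEnergy v Ψ ≤
Literature.MathematicalPhysics.QuantumManyBody.BoseGas.periodicGroundStateEnergy v (N + 1)
(Literature.MathematicalPhysics.QuantumManyBody.BoseGas.sideLength ρ (N + 1)) + δ → ENNReal.ofReal c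
≤ ENNReal.ofReal ((Literature.MathematicalPhysics.QuantumManyBody.BoseGas.sideLength ρ (N + 1) ^
3)⁻¹) * (‖∫ X in Literature.MathematicalPhysics.QuantumManyBody.BoseGas.cellN N
(Literature.MathematicalPhysics.QuantumManyBody.BoseGas.sideLength ρ (N + 1)), conj (Θ.ψ X) * ∫ x in
Literature.MathematicalPhysics.QuantumManyBody.BoseGas.cell
(Literature.MathematicalPhysics.QuantumManyBody.BoseGas.sideLength ρ (N + 1)), Ψ.ψ (Matrix.vecCons x
X)‖₊ : ENNReal) ^ 2`

## Assembly
Pure logic (checked sorry-free in Sketch.lean: `fun h1 h2 h3 h4 v hv => h4 v hv (h3 (h2 h1) v hv)`):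
CorrectorClosure turns StaticResponseBound
into InsertionResidue, ResidueCondenses turns that into PeriodicBEC (all v), and
BoundaryTransferWeak applied per potential yields
HasGroundStateBEC v ρ for ρ < ρ₀(v), i.e.
Literature.MathematicalPhysics.QuantumManyBody.BoseGas.BoseEinsteinCondensation = the conjunct
`BoseEinsteinCondensation` of Summits/AtomisticToContinuum (abbrev in
BoseEinsteinCondensation/Statement.lean).

Rationale: WHY THIS LINE. The mechanism is homogenisation theory's: Kipnis–Varadhan / De
Masi–Ferrari–Goldstein–Wick / Osada solve Poisson (corrector) equations
for additive functionals of a reversible, GAPLESS Markov environment in H₋₁ and never need a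
spectral gap (KipnisVaradhan1986, Osada1998,
GuoPapanicolaouVaradhan1988, KipnisLandim1999; quantitative form GloriaMourrat2013); Spohn1987 /
DybalskiSpohn2020 / MukherjeeVaradhan2019
already point that machinery at a quantum ground-state question (polaron effective mass = CLT
variance of the ground-state-transformed
process). Here the environment is the interacting N-boson ground state itself, the tagged particle
is the (N+1)-st boson, the additive
functional is W̃ = Σ_j v(y−x_j) − ρ∫v, and the target is not a diffusivity but FLATNESS of the
principal eigenfunction h (relative
variance bounded ⇔ Z_N ≥ c ⇔ insertion-type condensate formula of PenroseOnsager1956 / Reatto1969).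
The one estimate imported from
Bose-gas energy technology is the static response bound StaticResponseBound (second-order energy
response to λΣcos(k·x_j), LDA +
localized Bogoliubov: FournaisSolovej2020, Fournais2020), which is exactly what makes the FIRST
corrector L²-bounded uniformly in L — the
mobile particle's recoil turns the dynamic input ∫S(k,ω)(ω+k²)⁻²dω into the static m₋₁(k)/k²
(GuentherEtAl2021: the bosonic
orthogonality catastrophe occurs iff the bath is ideal, i.e. infinitely compressible). Unlike the
four existing routes (infrared bound,
periodic reduction, pinning, RG) nothing here is an energy-window argument or a gap bookkeeping: the
true ground states enter through
their eigen-equation and positivity (outside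
Literature.Barriers.AtomisticToContinuum.KineticGapLengthScalesNarrow's class), and the
expansion is in DENSITY functionals with derivative (∇χ·∇χ) vertices, the IR-finite side of
BogoliubovPerturbationInfraredNarrow.

RANKED CRUXES. #0 InsertionResidue (target) — X as in § Thesis: no orthogonality catastrophe for
zero-momentum insertion — uniformly positive overlap |⟨φ₀⊗Θ_N, Ψ_{N+1}⟩|² ≥ c between
δ-near-minimisers of the periodic N- and (N+1)-body energies on the torus of side ((N+1)/ρ)^{1/3}, ρ
< ρ₀(v), N large (card kv-insertion-corrector K3 target quantity; in Bogoliubov theory Z_N = 1 −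
O(√(ρa³))). (why it might fail: Z_N→0 (insertion orthogonality catastrophe) does occur when the bath
is ideal, even for a mobile particle (GuentherEtAl2021 eqs (3),(10)); here the bath is the
interacting gas itself, so Z_N ≥ c presupposes finite compressibility uniformly in L=(N/ρ)^{1/3} —
open, morally as hard as BEC.) [GuentherEtAl2021, PenroseOnsager1956, Reatto1969,
LiebSeiringerSolovejYngvason2005, LampartTriay2025]
#2 CorrectorClosure (crux) — StaticResponseBound (stated verbatim as hypothesis) implies
InsertionResidue: given the uniform static-response energy bound for v, the Kipnis–Varadhan
corrector hierarchy for −log h, h = Ψ_{N+1}/Ψ_N the principal eigenfunction of −G_N − Δ_y + Σ_j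
v(y−x_j) over the ground-state diffusion of the N-gas, converges in L²∩H¹(|Ψ_N|²dX⊗dy) with
constants uniform in N, L at small ρ, whence Var log h ≤ C and Z_N = (Eh)²/Eh² ≥ c (card K2; first
corrector = Reatto–Chester dressing û₁ = v̂/(e_k+k²)). [deps: StaticResponseBound] [difficulty: XL]
(why it might fail: the 2nd corrector's source |∇χ₁|²−E|∇χ₁|² is a TWO-mode density fluctuation
whose H₋₁/L² control needs 4-point dynamic correlations of the true ground state, not implied by the
2-point bound K1; Bogoliubov power counting is IR-finite (p·p′ vertices) but a rigorous contraction
may need more.) [KipnisVaradhan1986, Osada1998, Spohn1987, DybalskiSpohn2020, MukherjeeVaradhan2019,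
GloriaMourrat2013, ReattoChester1967, PistolesiEtAl2004]
#3 StaticResponseBound (crux) — STATIC RESPONSE BOUND (card K1, energy currency): for every
repulsive finite-range v there are ρ₀ > 0 and C such that for 0 < ρ < ρ₀, EVERY N, every k ∈ ℤ³∖{0}
(p = 2πk/L, L = (N/ρ)^{1/3}), every coupling t ∈ ℝ and every periodic trial state Ψ of finite
energy: ⟨Ψ,(H_N + tΣ_j cos(p·x_j))Ψ⟩ ≥ E₀^per(N,L) − C t² N / max(ρa, |p|²), a = scattering length —
i.e. the second-order energy response m₋₁(p)/2 is ≤ C/max(ρa,p²) (Bogoliubov: 1/(p²+16πρa))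
uniformly down to p = 2π/L and in N; large |t| is covered by the trivial bound −|t|N, a = 0 (free
gas) by Feshbach (e₁(t) ≥ −2t²/p²). [difficulty: L] (why it might fail: needs the CURVATURE of
E₀(H+tΣcos) in t uniformly in k down to 2π/L and in N at fixed small ρ — finer than LHY-precision
energies at k∼1/L (LDA + localized Bogoliubov must control second differences); a long-wavelength
density-wave softening m₋₁(k) ≫ 1/(ρa) would refute it.) [FournaisSolovej2020, Fournais2020,
doi:10.1007/s00023-021-01151-z, LiebSeiringerSolovejYngvason2005, GuentherEtAl2021]
#4 BoundaryTransferWeak (crux) — shared verbatim with route BECPeriodicReduction (item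
BoundaryTransferWeak): for each repulsive finite-range v, PeriodicBEC(v) (constant-mode occupation ≥
cN for δ-near-minimisers of the periodic energy on the torus of side (N/ρ)^{1/3}, ρ < ρ₀) implies
∃ρ₀>0 ∀ρ∈(0,ρ₀) HasGroundStateBEC v ρ (Dirichlet ground state, λ_max(γ) ≥ cN). Not glue:
Dirichlet/periodic energies differ by a wall term ≫ near-minimiser slack; expected route: Neumann
bracketing of interior sub-boxes + a mode-free criterion; fallback for THIS route: rerun the
corrector argument in the Dirichlet box with the mode-free criterion DirichletRemovalBound.
[difficulty: L] (why it might fail: PeriodicBEC(v) is ground-state-only (δ after N): the Dirichlet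
ground state lies a wall term ≫δ above E₀^per and interior restrictions are neither periodic nor of
sharp N, so the hypothesis may never fire (transfer≈conjunct); BEC is boundary-condition-sensitive
for attractive walls (Robinson 1976).) [LiebSeiringerSolovejYngvason2005, arXiv:2203.01841,
arXiv:2205.15284, doi:10.1007/bf01608554, Junge2026]
#9 ResidueCondenses (support) — InsertionResidue → PeriodicBEC (verbatim the PeriodicBEC signature
of route BECPeriodicReduction): pick a δ-near-minimiser Θ of the N-body problem (iInf_lt_iff, or any
state if E₀ = ⊤; the constant state shows PeriodicTrialState N L is inhabited), unfold
condensateOccupation (N+1) L Ψ = (N+1)L⁻³∫_{cell^N}|∫_cell Ψ(x,Y)dx|²dY, Cauchy–Schwarz against Θ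
(normalised on cell^N) gives ≥ (N+1)L⁻³|overlap|² ≥ c(N+1); shift ∀ᶠ N ↦ N+1. Lean-heavy parts:
Fubini/measurability for C¹ periodic integrands on the cell, Cauchy–Schwarz between ∫⁻ and the
Bochner integral. [difficulty: M] [LiebSeiringerSolovejYngvason2005, PenroseOnsager1956,
Fournais2020]
#9 DirichletRemovalBound (support) — mode-free removal bound in ANY box (operator inequality γ_Φ ≥
(N+1)|g⟩⟨g|, g(y) = ∫ conj Θ(X) Φ(y,X) dX for every normalised N-body Θ): (N+1)∫|g(y)|²dy ≤
maxOccupation (N+1) Φ for Dirichlet trial states Φ (N+1 bodies) and Θ (N bodies); proof: if g ≠ 0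
test maxOccupation with φ = g/‖g‖ and apply Cauchy–Schwarz against Θ in the remaining variables. It
is the transfer-free criterion for the Dirichlet rerun of the line (fallback if BoundaryTransferWeak
dies) and serves the insertion/swap family of cards. [difficulty: M] [PenroseOnsager1956,
LiebSeiringerSolovejYngvason2005]
#9 PeriodicBEC (support) — the shared torus statement PeriodicBEC of route BECPeriodicReduction
(stmt-0826; crux there, target of BECImpurityMassFlow), verbatim — constant-mode occupation ≥ cN for
δ-near-minimisers of the periodic N-body energy on the torus of side (N/ρ)^{1/3}, ρ < ρ₀(v), N
large. Attached here as bookkeeping: it is literally the conclusion of ResidueCondenses and the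
hypothesis BoundaryTransferWeak consumes, so this route is one of the method routes plugging into
the periodic reduction. [difficulty: open-problem] [LiebSeiringerSolovejYngvason2005, Fournais2020,
Junge2026]

TWO-LAYER PLAN. Foreseen glued splits (nothing filed now). CorrectorClosure ⇐ FirstCorrectorBounds
(K1 ⇒ ‖χ₁‖_{L²} + ‖∇χ₁‖ ≤ C(ρ) uniformly in N, L,
via the variational characterisation of ⟨AΨ_N,(H−E₀+k²)⁻¹AΨ_N⟩ by second-order energy response) →
HigherCorrectorContraction (H₋₁/L²
bounds for centred two-mode density functionals with recoil resolvents: a 4-point static-response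
statement, typable as the curvature
of E₀ under a TWO-body cosine perturbation λΣ_{i<j}cos(k·(x_i−x_j))) → CorrectorClosure.
StaticResponseBound ⇐ LargeK (k ≳ ℓ_F⁻¹: Neumann
localisation into Fournais boxes where complete BEC and Bogoliubov with an external potential are
theorems) → SmallK (k ≲ ℓ_F⁻¹: local
density approximation against e(ρ) with e″ ≥ 8πa(1−o(1))) → StaticResponseBound. If
BoundaryTransferWeak is refuted or stalls: open the
Dirichlet rerun as a sibling route (InsertionResidueDirichlet with the GP-profile-weighted mode g,
assembled through DirichletRemovalBound
→ le_condensateNumber, no transfer).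

KILL CRITERIA. ¬InsertionResidue for some admissible v at arbitrarily small ρ (an insertion
orthogonality catastrophe WITH interactions) closes the route
(`refuted:InsertionResidue`) and retires the insertion/residue family of cards, not the conjunct.
¬StaticResponseBound (a density-wave
softening m₋₁(k)·min(ρa,k²) unbounded along L=(N/ρ)^{1/3}) closes the route and wounds cards
one-particle-at-a-time / swap-overlap-no-catastrophe
(shared K1). StaticResponseBound ∧ ¬InsertionResidue refutes CorrectorClosure: close.
¬BoundaryTransferWeak: pivot to the Dirichlet rerun
(new sibling route via DirichletRemovalBound), this route's torus items survive as PeriodicBEC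
technology. PeriodicBEC proved elsewhere
moots cruxes 2–3 for the conjunct (the route then only explains Z_N).

NOT DECOMPOSED YET. The function spaces of the corrector hierarchy (ground-state Dirichlet form
Σ∫|∇_i f|²Ψ_N², H₋₁ of the product generator −G_N−Δ_y) and
the existence/positivity/uniqueness of finite-volume ground states (Perron–Frobenius; needed only
INSIDE proofs of CorrectorClosure, the
items are stated over near-minimisers); the exact identity E|∇log h|² = ρ_N∫v − μ_N (Born − chemical
potential ≥ 0, the expansion's
energy parameter) and μ_N ≤ ρ_N∫v; the k-regime split and constants of StaticResponseBound;
near-minimiser stability constants (δ below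
the finite-volume gaps); the 1-D diagnostic (first corrector ∫dk m₋₁/k² divergent, Var log h ∼ log N
for Girardeau) — all layer-2 or
prover-side lemmas (`--supports`).

CHEAPEST FALSIFIER. A refuter's closed-form Bogoliubov computation on the torus of the SECOND
corrector: ‖χ₂‖_{L²} and ⟨src,(H−E₀+q²)⁻¹src⟩ with
src = |∇_yχ₁|² − E|∇_yχ₁|², χ₁ = Σ_j u₁(y−x_j), û₁(p) = v̂(p)/(e_p+p²), e_p = √(p⁴+16πρa p²),
including the anomalous (u_pv_p) pair
amplitudes — if either grows like log L the contraction step of CorrectorClosure is dead at second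
order (only a resummed/RG version
could survive). Planner's own power counting (this session): q ≠ 0 part ∝ ρ²∫∫ |p||p−q|/(|p|+|p−q|)
× bounded — finite; q = 0 part is a
self-averaging bath functional of size O(1/V); first corrector ‖χ₁‖² = ρ∫|v̂|²S_p(e_p+p²)⁻²d³p/(2π)³
= O(√(ρa³)) finite. Second check:
StaticResponseBound at a = 0 must read E(t) ≥ −Ct²N/p²: true with C = 2 (Feshbach on the one-body
Mathieu problem) — passes.

NUMBERS. Bogoliubov (ħ = 2m = 1, μ = 8πρa): m₋₁(k) = ∫S(k,ω)ω⁻¹dω = 1/(k² + 16πρa) per particle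
(compressibility sum rule at k → 0, f-sum
m₁ = k²); S(k) = k²/e_k; depletion 1 − n₀/N = (8/(3√π))√(ρa³) (LiebSeiringerSolovejYngvason2005 Ch.
5/App.); ‖χ₁‖² = O(√(ρa³)),
E|∇log h|² = ρ∫v − μ_N ≈ (ρ/(2π)³)∫|v̂(k)|²/(2k²)d³k (second Born term) for soft v; Z_Bog = 1 −
O(√(ρa³)). Orthogonality benchmarks
(GuentherEtAl2021): static impurity in an IDEAL BEC Z₀ ≈ exp(−αN^{1/3}(k_na)²) (eq. (3)); mobile
impurity in the interacting BEC
Z = exp(−N_ξ∫|φ̃−1|²) > 0 (eq. (10)). Energy-window ceiling of the gap methods: L/a ≲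
(ρa³)^{-3/4-η/2} (Junge2026 Cor. 6; barrier
KineticGapLengthScalesNarrow). Items at open: 8 (1 target, 3 cruxes, 3 support incl. the shared
PeriodicBEC, 1 assembly).

DEFINITION REQUESTS. None needed for the filed items (PeriodicTrialState, periodicEnergy,
periodicGroundStateEnergy, condensateOccupation, cell, cellN,
sideLength, scatteringLength, TrialState, maxOccupation, HasGroundStateBEC all exist in
Literature.MathematicalPhysics.QuantumManyBody.BoseGas).
Foreseen when CorrectorClosure is split: a `GroundStateDirichletForm`/H₋₁ vocabulary over |Ψ|²dX
(topic Summits/AtomisticToContinuum/BoseEinsteinCondensation/Theorems)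
so that FirstCorrectorBounds can be an item rather than prose.

Novelty: Searches (2026-08-15): `lit frontier AtomisticToContinuum --since 2020` (30 rows; BEC descendants
arXiv:2603.20776, arXiv:2510.20493,
arXiv:2602.16566 — all gap/localisation; no homogenisation link); `lit bridges AtomisticToContinuum
--cross any` (30 rows; the
KipnisLandim1999-rooted bridges are hydrodynamic-limit papers, none touches the Bose roots); `lit
search --source crossref` ×5
("Kipnis Varadhan polaron effective mass central limit theorem" → KipnisVaradhan1986,
MukherjeeVaradhan2019, doi:10.1214/25-aop1791,
GloriaMourrat2013; "Bose polaron quasiparticle residue ground state overlap"; "orthogonality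
catastrophe impurity Bose Einstein condensate"
→ GuentherEtAl2021 = doi:10.1103/physreva.103.013317, read pp. 1–2; "chemical potential insertion
ground state ratio … Penrose Onsager"
→ doi:10.1098/rspa.1960.0095, doi:10.1103/physrev.104.576; "linear response dilute Bose gas periodic
potential ground state energy
rigorous" → doi:10.1007/s00220-009-0977-z, doi:10.1063/1.3376639, nothing on uniform-in-k response);
`lit galaxy search "Kipnis-Varadhan"
--star pdf` (12 hits: RWRE/homogenisation/KPZ, none quantum; `--star all` saturated, 0 rows); local
`lit search --hybrid` unavailable
this session (searchd reset); arXiv/OpenAlex HTTP 429. Plus the card's two novelty audits (audit-4,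
audit-14).
Nearest prior art found: Spohn1987, DybalskiSpohn2020, MukherjeeVaradhan2019 (Kipnis–Varadhan/CLT
variance of the ground-state-transformed
process = polaron effective mass: KV already point  [refs: 10.1214/25-aop1791, 10.1103/physreva.103.013317, 10.1098/rspa.1960.0095, 10.1103/physrev.104.576, 10.1007/s00220-009-0977-z, 10.1063/1.3376639, 2603.20776, 2510.20493, 2602.16566, doi:10.1214/25-aop1791, doi:10.1103/physreva.103.013317, doi:10.1098/rspa.1960.0095, doi:10.1103/physrev.104.576, doi:10.1007/s00220-009-0977-z, doi:10.1063/1.3376639, KipnisLandim1999, KipnisVaradhan1986, MukherjeeVarad]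

Barriers (technique_class: kipnis-varadhan corrector-expansion perturbation-theory): - technique_class: kipnis-varadhan corrector-expansion perturbation-theory
- Literature.Barriers.AtomisticToContinuum.BogoliubovPerturbationInfrared: applies in spirit to
CorrectorClosure (an expansion at T = 0, d = 3); evaded because every expanded object is a
local-gauge-invariant DENSITY functional of the bath sandwiched by recoil resolvents (ω+k²)⁻¹ and
the hierarchy's nonlinearity is |∇χ|² (derivative vertices p·p′) — no anomalous propagator Σ₁₂ or
phase field is ever formed; the honest residual risk (a log L in the two-mode term) is
CorrectorClosure's stated failure mode and the cheapest falsifier.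
- Literature.Barriers.AtomisticToContinuum.BogoliubovPerturbationInfraredNarrow: places the line on
its NOT-covered side: density response/compressibility expansions (i) and derivative couplings —
conjunct (2) with s = 2 says exactly that vertices vanishing like |k|² make the bubble integrable in
d = 3, which is the planner's power counting for χ₂.
- Literature.Barriers.AtomisticToContinuum.KineticGapLengthScales: evaded — no Poincaré/kinetic gap
at any scale; solvability of the corrector equations is H₋₁ (Kipnis–Varadhan) and the only "mass" is
the added particle's recoil k², uniform in L; StaticResponseBound may USE gap technology but only
inside Fournais boxes (large k), never at the thermodynamic scale.
- Literature.Barriers.AtomisticToContinuum.KineticGapLengthScalesNarrow: its class is energy-WINDOW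
arguments; InsertionResidue/PeriodicBEC here have δ chosen after N (bel

History (route lifecycle, newest last):
- 2026-08-15T13:40:05Z · CLOSED retired — not-a-thesis: assembly does not conclude the sub-problem Statement (operator:999:1257524)

sub-problem: BoseEinsteinCondensation · status: closed(retired) · opened planner-plancard-AtomisticToContinuum-BoseEin-2a38647a-0 2026-08-15T11:33:22Z · rev 0 · ledger route-AtomisticToContinuum-BECRecoilCorrector
GENERATED by the gate from the ledger (D-0016/17). Provers cite these decls: `theorem foo : Summit.AtomisticToContinuum.BoseEinsteinCondensation.Theses.BECRecoilCorrector.<Decl> := …` in Summits/AtomisticToContinuum/BoseEinsteinCondensation/Theorems/<Name>.lean.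
-/

namespace Summit.AtomisticToContinuum.BoseEinsteinCondensation.Theses.BECRecoilCorrector

open scoped BigOperators Topology Manifold Classical MeasureTheory ProbabilityTheory Matrix InnerProductSpace ComplexConjugate ContinuousMap
open Filter Set Function TopologicalSpace MeasureTheory

attribute [summit_statement] _root_.BoseEinsteinCondensation

/-- item stmt-AtomisticToContinuum-4385 · target · rank 0 · closed · moot by None · by planner
why it might fail: Z_N→0 (insertion orthogonality catastrophe) does occur when the bath is ideal, even for a mobile particle (GuentherEtAl2021 eqs (3),(10)); here the bath is the interacting gas itself, so Z_N ≥ c presupposes finite compressibility uniformly in L=(N/ρ)^{1/3} — open, morally as hard as BEC.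
sources: GuentherEtAl2021, PenroseOnsager1956, Reatto1969, LiebSeiringerSolovejYngvason2005, LampartTriay2025
[target] X as in § Thesis: no orthogonality catastrophe for zero-momentum insertion — uniformly
positive overlap |⟨φ₀⊗Θ_N, Ψ_{N+1}⟩|² ≥ c between δ-near-minimisers of the periodic N- and
(N+1)-body energies on the torus of side ((N+1)/ρ)^{1/3}, ρ < ρ₀(v), N large (card
kv-insertion-corrector K3 target quantity; in Bogoliubov theory Z_N = 1 − O(√(ρa³))). -/
@[route_item "route-AtomisticToContinuum-BECRecoilCorrector", crux]
def InsertionResidue : Prop :=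
  ∀ v : ℝ → ENNReal, Literature.MathematicalPhysics.QuantumManyBody.BoseGas.IsRepulsiveFiniteRange v → ∃ ρ₀ : ℝ, 0 < ρ₀ ∧ ∀ ρ : ℝ, 0 < ρ → ρ < ρ₀ → ∃ c : ℝ, 0 < c ∧ ∀ᶠ N : ℕ in Filter.atTop, ∃ δ : ENNReal, 0 < δ ∧ ∀ Θ : Literature.MathematicalPhysics.QuantumManyBody.BoseGas.PeriodicTrialState N (Literature.MathematicalPhysics.QuantumManyBody.BoseGas.sideLength ρ (N + 1)), ∀ Ψ : Literature.MathematicalPhysics.QuantumManyBody.BoseGas.PeriodicTrialState (N + 1) (Literature.MathematicalPhysics.QuantumManyBody.BoseGas.sideLength ρ (N + 1)), Literature.MathematicalPhysics.QuantumManyBody.BoseGas.periodicEnergy v Θ ≤ Literature.MathematicalPhysics.QuantumManyBody.BoseGas.periodicGroundStateEnergy v N (Literature.MathematicalPhysics.QuantumManyBody.BoseGas.sideLength ρ (N + 1)) + δ → Literature.MathematicalPhysics.QuantumManyBody.BoseGas.periodicEnergy v Ψ ≤ Literature.MathematicalPhysics.QuantumManyBody.BoseGas.periodicGroundStateEnergy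 v (N + 1) (Literature.MathematicalPhysics.QuantumManyBody.BoseGas.sideLength ρ (N + 1)) + δ → ENNReal.ofReal c ≤ ENNReal.ofReal ((Literature.MathematicalPhysics.QuantumManyBody.BoseGas.sideLength ρ (N + 1) ^ 3)⁻¹) * (‖∫ X in Literature.MathematicalPhysics.QuantumManyBody.BoseGas.cellN N (Literature.MathematicalPhysics.QuantumManyBody.BoseGas.sideLength ρ (N + 1)), conj (Θ.ψ X) * ∫ x in Literature.MathematicalPhysics.QuantumManyBody.BoseGas.cell (Literature.MathematicalPhysics.QuantumManyBody.BoseGas.sideLength ρ (N + 1)), Ψ.ψ (Matrix.vecCons x X)‖₊ : ENNReal) ^ 2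

/-- item stmt-AtomisticToContinuum-4386 · crux · rank 2 · closed · moot by None · by planner
why it might fail: the 2nd corrector's source |∇χ₁|²−E|∇χ₁|² is a TWO-mode density fluctuation whose H₋₁/L² control needs 4-point dynamic correlations of the true ground state, not implied by the 2-point bound K1; Bogoliubov power counting is IR-finite (p·p′ vertices) but a rigorous contraction may need more.
sources: KipnisVaradhan1986, Osada1998, Spohn1987, DybalskiSpohn2020, MukherjeeVaradhan2019, GloriaMourrat2013
[crux] StaticResponseBound (stated verbatim as hypothesis) implies InsertionResidue: given the
uniform static-response energy bound for v, the Kipnis–Varadhan corrector hierarchy for −log h, h =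
Ψ_{N+1}/Ψ_N the principal eigenfunction of −G_N − Δ_y + Σ_j v(y−x_j) over the ground-state diffusion
of the N-gas, converges in L²∩H¹(|Ψ_N|²dX⊗dy) with constants uniform in N, L at small ρ, whence Var
log h ≤ C and Z_N = (Eh)²/Eh² ≥ c (card K2; first corrector = Reatto–Chester dressing û₁ =
v̂/(e_k+k²)). [deps: StaticResponseBound] [difficulty: XL] -/
@[route_item "route-AtomisticToContinuum-BECRecoilCorrector", crux]
def CorrectorClosure : Prop :=
  (∀ v : ℝ → ENNReal, Literature.MathematicalPhysics.QuantumManyBody.BoseGas.IsRepulsiveFiniteRange v → ∃ ρ₀ : ℝ, 0 < ρ₀ ∧ ∃ C : ℝ, 0 < C ∧ ∀ ρ : ℝ, 0 < ρ → ρ < ρ₀ → ∀ N : ℕ, ∀ k : Fin 3 → ℤ, k ≠ 0 → ∀ t : ℝ, ∀ Ψ : Literature.MathematicalPhysics.QuantumManyBody.BoseGas.PeriodicTrialState N (Literature.MathematicalPhysics.QuantumManyBody.BoseGas.sideLength ρ N), Literature.MathematicalPhysics.QuantumManyBody.BoseGas.periodicEnergy v Ψ ≠ ⊤ → (Literature.MathematicalPhysics.QuantumManyBody.BoseGas.periodicGroundStateEnergy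 v N (Literature.MathematicalPhysics.QuantumManyBody.BoseGas.sideLength ρ N)).toReal - C * t ^ 2 * N / max (ρ * (Literature.MathematicalPhysics.QuantumManyBody.BoseGas.scatteringLength v).toReal) ((2 * Real.pi / Literature.MathematicalPhysics.QuantumManyBody.BoseGas.sideLength ρ N) ^ 2 * ∑ i, (k i : ℝ) ^ 2) ≤ (Literature.MathematicalPhysics.QuantumManyBody.BoseGas.periodicEnergy v Ψ).toReal + t * ∫ X in Literature.MathematicalPhysics.QuantumManyBody.BoseGas.cellN N (Literature.MathematicalPhysics.QuantumManyBody.BoseGas.sideLength ρ N), (∑ j, Real.cos (2 * Real.pi / Literature.MathematicalPhysics.QuantumManyBody.BoseGas.sideLength ρ N * ∑ i, (k i : ℝ) * X j i)) * ‖Ψ.ψ X‖ ^ 2) → InsertionResidue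

/-- item stmt-AtomisticToContinuum-4387 · crux · rank 3 · closed · moot by None · by planner
why it might fail: needs the CURVATURE of E₀(H+tΣcos) in t uniformly in k down to 2π/L and in N at fixed small ρ — finer than LHY-precision energies at k∼1/L (LDA + localized Bogoliubov must control second differences); a long-wavelength density-wave softening m₋₁(k) ≫ 1/(ρa) would refute it.
sources: FournaisSolovej2020, Fournais2020, doi:10.1007/s00023-021-01151-z, LiebSeiringerSolovejYngvason2005, GuentherEtAl2021
[crux] STATIC RESPONSE BOUND (card K1, energy currency): for every repulsive finite-range v there
are ρ₀ > 0 and C such that for 0 < ρ < ρ₀, EVERY N, every k ∈ ℤ³∖{0} (p = 2πk/L, L = (N/ρ)^{1/3}),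
every coupling t ∈ ℝ and every periodic trial state Ψ of finite energy: ⟨Ψ,(H_N + tΣ_j cos(p·x_j))Ψ⟩
≥ E₀^per(N,L) − C t² N / max(ρa, |p|²), a = scattering length — i.e. the second-order energy
response m₋₁(p)/2 is ≤ C/max(ρa,p²) (Bogoliubov: 1/(p²+16πρa)) uniformly down to p = 2π/L and in N;
large |t| is covered by the trivial bound −|t|N, a = 0 (free gas) by Feshbach (e₁(t) ≥ −2t²/p²).
[difficulty: L] -/
@[route_item "route-AtomisticToContinuum-BECRecoilCorrector", crux]
def StaticResponseBound : Prop :=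
  ∀ v : ℝ → ENNReal, Literature.MathematicalPhysics.QuantumManyBody.BoseGas.IsRepulsiveFiniteRange v → ∃ ρ₀ : ℝ, 0 < ρ₀ ∧ ∃ C : ℝ, 0 < C ∧ ∀ ρ : ℝ, 0 < ρ → ρ < ρ₀ → ∀ N : ℕ, ∀ k : Fin 3 → ℤ, k ≠ 0 → ∀ t : ℝ, ∀ Ψ : Literature.MathematicalPhysics.QuantumManyBody.BoseGas.PeriodicTrialState N (Literature.MathematicalPhysics.QuantumManyBody.BoseGas.sideLength ρ N), Literature.MathematicalPhysics.QuantumManyBody.BoseGas.periodicEnergy v Ψ ≠ ⊤ → (Literature.MathematicalPhysics.QuantumManyBody.BoseGas.periodicGroundStateEnergy v N (Literature.MathematicalPhysics.QuantumManyBody.BoseGas.sideLength ρ N)).toReal - C * t ^ 2 * N / max (ρ * (Literature.MathematicalPhysics.QuantumManyBody.BoseGas.scatteringLength v).toReal) ((2 * Real.pi / Literature.MathematicalPhysics.QuantumManyBody.BoseGas.sideLength ρ N) ^ 2 * ∑ i, (k i : ℝ) ^ 2) ≤ (Literature.MathematicalPhysics.QuantumManyBody.BoseGas.periodicEnergy v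 Ψ).toReal + t * ∫ X in Literature.MathematicalPhysics.QuantumManyBody.BoseGas.cellN N (Literature.MathematicalPhysics.QuantumManyBody.BoseGas.sideLength ρ N), (∑ j, Real.cos (2 * Real.pi / Literature.MathematicalPhysics.QuantumManyBody.BoseGas.sideLength ρ N * ∑ i, (k i : ℝ) * X j i)) * ‖Ψ.ψ X‖ ^ 2

/-- item stmt-AtomisticToContinuum-0827 · crux · rank 4 · open · by planner
why it might fail: PeriodicBEC(v) is ground-state-only (δ after N): the Dirichlet ground state lies a wall term ≫δ above E₀^per and interior restrictions are neither periodic nor of sharp N, so the hypothesis may never fire (transfer≈conjunct); BEC is boundary-condition-sensitive for attractive walls (Robinson 1976).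
sources: LiebSeiringerSolovejYngvason2005, arXiv:2203.01841, arXiv:2205.15284, doi:10.1007/bf01608554, Junge2026
[crux] BoundaryTransferWeak (mode-free boundary-condition transfer, per potential): for each
repulsive finite-range v, PeriodicBEC(v) implies ∃ρ₀>0 ∀ρ∈(0,ρ₀) HasGroundStateBEC v ρ (Dirichlet
ground state, λ_max(γ) ≥ cN via condensateNumber). Not glue: near-minimiser slacks are O(N/L²) while
Dirichlet/periodic energies differ by a boundary term ≫ N/L², so no energy-comparison proof;
expected route: Neumann bracketing of interior sub-boxes (−Δ_Dir ≥ ⊕−Δ_Neu, v ≥ 0) + a mode-free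
criterion (λ_max ≥ tr γ²/N). Only the ENERGY analogue is in print (LiebSeiringerSolovejYngvason2005
Ch. 2 after (2.8)). v ≡ 0: hypothesis and conclusion both true. -/
@[route_item "route-AtomisticToContinuum-BECRecoilCorrector"]
def BoundaryTransferWeak : Prop :=
  ∀ v : ℝ → ENNReal, Literature.MathematicalPhysics.QuantumManyBody.BoseGas.IsRepulsiveFiniteRange v → (∃ ρ₀ : ℝ, 0 < ρ₀ ∧ ∀ ρ : ℝ, 0 < ρ → ρ < ρ₀ → ∃ c : ℝ, 0 < c ∧ ∀ᶠ N : ℕ in Filter.atTop, ∃ δ : ENNReal, 0 < δ ∧ ∀ Ψ : Literature.MathematicalPhysics.QuantumManyBody.BoseGas.PeriodicTrialState N (Literature.MathematicalPhysics.QuantumManyBody.BoseGas.sideLength ρ N), Literature.MathematicalPhysics.QuantumManyBody.BoseGas.periodicEnergy v Ψ ≤ Literature.MathematicalPhysics.QuantumManyBody.BoseGas.periodicGroundStateEnergy v N (Literature.MathematicalPhysics.QuantumManyBody.BoseGas.sideLength ρ N) + δ → ENNReal.ofReal (c * N) ≤ Literature.MathematicalPhysics.QuantumManyBody.BoseGas.condensateOccupation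 N (Literature.MathematicalPhysics.QuantumManyBody.BoseGas.sideLength ρ N) Ψ.ψ) → ∃ ρ₀ : ℝ, 0 < ρ₀ ∧ ∀ ρ : ℝ, 0 < ρ → ρ < ρ₀ → Literature.MathematicalPhysics.QuantumManyBody.BoseGas.HasGroundStateBEC v ρ

/-- item stmt-AtomisticToContinuum-0826 · support · rank 9 · closed · moot by None · by planner
sources: LiebSeiringerSolovejYngvason2005, Fournais2020, Junge2026
[crux] PeriodicBEC: for every repulsive finite-range radial v there is ρ₀>0 such that for 0<ρ<ρ₀
there is c>0 with: for all large N there is δ>0 such that every PERIODIC trial state Ψ on the torus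
of side L=(N/ρ)^{1/3} with periodicEnergy ≤ E₀^per(N,L)+δ has constant-mode occupation ⟨Ψ,n₀Ψ⟩ =
condensateOccupation N L Ψ ≥ cN. The open problem in the literature's own (translation-invariant)
setting; Fournais2020 Thm 1.2 gives it on scales L ≤ C(ρa³)^{-δ}(ρa)^{-1/2}, Junge2026 Cor. 6
(Neumann) up to a(ρa³)^{-3/4-η}. Sources: LiebSeiringerSolovejYngvason2005 Ch. 5; Fournais2020;
Junge2026; ChongLiangNam2026. -/
@[route_item "route-AtomisticToContinuum-BECRecoilCorrector"]
def PeriodicBEC : Prop :=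
  ∀ v : ℝ → ENNReal, Literature.MathematicalPhysics.QuantumManyBody.BoseGas.IsRepulsiveFiniteRange v → ∃ ρ₀ : ℝ, 0 < ρ₀ ∧ ∀ ρ : ℝ, 0 < ρ → ρ < ρ₀ → ∃ c : ℝ, 0 < c ∧ ∀ᶠ N : ℕ in Filter.atTop, ∃ δ : ENNReal, 0 < δ ∧ ∀ Ψ : Literature.MathematicalPhysics.QuantumManyBody.BoseGas.PeriodicTrialState N (Literature.MathematicalPhysics.QuantumManyBody.BoseGas.sideLength ρ N), Literature.MathematicalPhysics.QuantumManyBody.BoseGas.periodicEnergy v Ψ ≤ Literature.MathematicalPhysics.QuantumManyBody.BoseGas.periodicGroundStateEnergy v N (Literature.MathematicalPhysics.QuantumManyBody.BoseGas.sideLength ρ N) + δ → ENNReal.ofReal (c * N) ≤ Literature.MathematicalPhysics.QuantumManyBody.BoseGas.condensateOccupation N (Literature.MathematicalPhysics.QuantumManyBody.BoseGas.sideLength ρ N) Ψ.ψ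

/-- item stmt-AtomisticToContinuum-4388 · support · rank 9 · closed · moot by None · by planner
sources: LiebSeiringerSolovejYngvason2005, PenroseOnsager1956, Fournais2020
[support] InsertionResidue → PeriodicBEC (verbatim the PeriodicBEC signature of route
BECPeriodicReduction): pick a δ-near-minimiser Θ of the N-body problem (iInf_lt_iff, or any state if
E₀ = ⊤; the constant state shows PeriodicTrialState N L is inhabited), unfold condensateOccupation
(N+1) L Ψ = (N+1)L⁻³∫_{cell^N}|∫_cell Ψ(x,Y)dx|²dY, Cauchy–Schwarz against Θ (normalised on cell^N)
gives ≥ (N+1)L⁻³|overlap|² ≥ c(N+1); shift ∀ᶠ N ↦ N+1. Lean-heavy parts: Fubini/measurability for C¹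
periodic integrands on the cell, Cauchy–Schwarz between ∫⁻ and the Bochner integral. [difficulty: M] -/
@[route_item "route-AtomisticToContinuum-BECRecoilCorrector"]
def ResidueCondenses : Prop :=
  InsertionResidue → ∀ v : ℝ → ENNReal, Literature.MathematicalPhysics.QuantumManyBody.BoseGas.IsRepulsiveFiniteRange v → ∃ ρ₀ : ℝ, 0 < ρ₀ ∧ ∀ ρ : ℝ, 0 < ρ → ρ < ρ₀ → ∃ c : ℝ, 0 < c ∧ ∀ᶠ N : ℕ in Filter.atTop, ∃ δ : ENNReal, 0 < δ ∧ ∀ Ψ : Literature.MathematicalPhysics.QuantumManyBody.BoseGas.PeriodicTrialState N (Literature.MathematicalPhysics.QuantumManyBody.BoseGas.sideLength ρ N), Literature.MathematicalPhysics.QuantumManyBody.BoseGas.periodicEnergy v Ψ ≤ Literature.MathematicalPhysics.QuantumManyBody.BoseGas.periodicGroundStateEnergy v N (Literature.MathematicalPhysics.QuantumManyBody.BoseGas.sideLength ρ N) + δ → ENNReal.ofReal (c * N) ≤ Literature.MathematicalPhysics.QuantumManyBody.BoseGas.condensateOccupation N (Literature.MathematicalPhysics.QuantumManyBody.BoseGas.sideLength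 ρ N) Ψ.ψ

/-- item stmt-AtomisticToContinuum-4389 · support · rank 9 · closed · moot by None · by planner
sources: PenroseOnsager1956, LiebSeiringerSolovejYngvason2005
[support] mode-free removal bound in ANY box (operator inequality γ_Φ ≥ (N+1)|g⟩⟨g|, g(y) = ∫ conj
Θ(X) Φ(y,X) dX for every normalised N-body Θ): (N+1)∫|g(y)|²dy ≤ maxOccupation (N+1) Φ for Dirichlet
trial states Φ (N+1 bodies) and Θ (N bodies); proof: if g ≠ 0 test maxOccupation with φ = g/‖g‖ and
apply Cauchy–Schwarz against Θ in the remaining variables. It is the transfer-free criterion for the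
Dirichlet rerun of the line (fallback if BoundaryTransferWeak dies) and serves the insertion/swap
family of cards. [difficulty: M] -/
@[route_item "route-AtomisticToContinuum-BECRecoilCorrector"]
def DirichletRemovalBound : Prop :=
  ∀ (N : ℕ) (L : ℝ) (Φ : Literature.MathematicalPhysics.QuantumManyBody.BoseGas.TrialState (N + 1) L) (Θ : Literature.MathematicalPhysics.QuantumManyBody.BoseGas.TrialState N L), ((N : ENNReal) + 1) * ∫⁻ y, (‖∫ X, conj (Θ.ψ X) * Φ.ψ (Matrix.vecCons y X)‖₊ : ENNReal) ^ 2 ≤ Literature.MathematicalPhysics.QuantumManyBody.BoseGas.maxOccupation (N + 1) Φ.ψ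

/-- item stmt-AtomisticToContinuum-4390 · assembly · rank 1 · closed · moot by None · by planner
sources: LiebSeiringerSolovejYngvason2005, PenroseOnsager1956
[assembly] StaticResponseBound → CorrectorClosure → ResidueCondenses → BoundaryTransferWeak →
BoseEinsteinCondensation. -/
@[route_item "route-AtomisticToContinuum-BECRecoilCorrector"]
def Assembly : Prop :=
  StaticResponseBound → CorrectorClosure → ResidueCondenses → BoundaryTransferWeak → Literature.MathematicalPhysics.QuantumManyBody.BoseGas.BoseEinsteinCondensation

end Summit.AtomisticToContinuum.BoseEinsteinCondensation.Theses.BECRecoilCorrector
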